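import Summits.Parity.BatemanHorn.Theorems.SoloInformedLocatedWindowMass

/-!
# SoloInformedWindowRootFourier — roots of `g` in an incomplete interval: finite Fourier completion by Hooley sums

Solo unit `solo-Parity-informed` (ideation tier, informed mode), session 142; `PLAN.md` §107, CLAIMS C243.
First file of the HOOLEY-SUM TYPING of the open content of the `d ≥ 3` rung below the parity wall
(`SoloInformedLocatedHeuristic`: for irreducible `g` of degree `d ≥ 2`, Erdős's asymptotic `∑_{n≤x} τ(|g(n)|) ~ d·A_g·x log x`
⟺ `WindowRootEquidistribution g`, i.e. `Mid_g(x) − H_g(x) = o(x log x)`, where `Mid_g(x)` counts the roots `n ≤ x` of `g`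
to the moduli `e` of the LOCATED WINDOW `x < e < √|g(n)|` and `H_g` is its CRT heuristic; proved for `d = 2`, open for every
irreducible `g` of degree `≥ 3`, NOT parity-blocked).  For a modulus `e > x` the `n ∈ [1, x]` with `e ∣ g(n)` ARE the roots of
`g` modulo `e` lying in `[1, x]`: counting them is counting roots in an INCOMPLETE interval of `ℤ/e`, and completing the interval
costs exactly the non-zero frequencies of Hooley's exponential sums over roots

  `S_g(h; q) = ∑_{ν mod q, g(ν) ≡ 0 (mod q)} e(hν/q)`      (`hooleySum`; C. Hooley, Mathematika 11 (1964) 39–49).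

Contents (elementary finite Fourier analysis on `ℤ/q`; the window / located-count identities are in the sequel
`SoloInformedWindowRootFourierLocated`):

* `eAdd q k = e(k/q)`; `sum_range_eAdd_mul` — orthogonality `∑_{h<q} e(hk/q) = q·[q ∣ k]` (via `Complex.isPrimitiveRoot_exp`);
* `sum_kernel_mul_charSum_eq_card_inter` — for residue sets `A, B ⊆ [0, q)`:
  `∑_{h<q} (∑_{m∈B} e(−hm/q))·(∑_{ν∈A} e(hν/q)) = q·#(A ∩ B)`;
* `rootResidues g q` (the roots among `0, …, q−1`; `card_rootResidues`: `# = ρ_g(q) = polyRootCountMod ![g] q`),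
  `hooleySum g q h = S_g(h; q)` (`hooleySum_zero = ρ_g(q)`, `norm_hooleySum_le : |S_g(h;q)| ≤ ρ_g(q)`);
* `intervalKernel q a b h = F_{[a,b]}(h; q) = ∑_{a≤m≤b} e(−hm/q)` with `intervalKernel_zero = b+1−a`, the trivial bound
  `norm_intervalKernel_le_card`, the geometric-sum identity `intervalKernel_mul_sub_one`, `norm_eAdd_neg_sub_one`
  (`|e(−h/q) − 1| = 2|sin(πh/q)|`), `norm_intervalKernel_le_inv_sin` (`≤ 1/|sin(πh/q)|`, `q ∤ h`), Jordan's inequality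
  `two_mul_min_div_le_abs_sin` (`|sin(πh/q)| ≥ 2 min(h, q−h)/q`, from `Real.mul_le_sin`), and the Pólya–Vinogradov kernel bound
  `norm_intervalKernel_le_min : |F_{[a,b]}(h; q)| ≤ min(b+1−a, q/(2·min(h, q−h)))` for `0 < h < q`;
* `card_rootResidues_inter_Icc_mul_eq` / `card_rootResidues_inter_Icc_mul_sub_eq` — the EXACT expansion, for `b < q`:
  `q·#{ν ∈ [a,b] : g(ν) ≡ 0 (q)} − (b+1−a)·ρ_g(q) = ∑_{0<h<q} F_{[a,b]}(h; q)·S_g(h; q)`;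
* `abs_card_rootResidues_inter_Icc_sub_le` — the COMPLETION INEQUALITY
  `|#{roots in [a,b]} − (b+1−a)ρ_g(q)/q| ≤ (1/q)·∑_{0<h<q} min(b+1−a, q/(2 min(h,q−h)))·|S_g(h; q)|`.

Per modulus this is empty of content past `x` (for a prime `q = p > x`, `|S_g(h; p)| ≤ ρ_g(p) ≤ d` and the inequality reads
`O(d) ≤ O(d log p)`); the content of the rung is cancellation in the sum over the MODULI of `S_g(h; e)` twisted by the kernel —
see the sequel's docstring.  A typing of the obstruction, below the parity wall of `paper/SHARPEST-STATEMENT.md` §2; no path to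
`BatemanHornConjecture`.  No sorry, no new axioms (Mathlib: `Complex.isPrimitiveRoot_exp`, `IsPrimitiveRoot.zpow_eq_one_iff_dvd`,
`geom_sum_eq`, `geom_sum_Ico_mul`, `Complex.norm_exp_I_mul_ofReal_sub_one`, `Real.mul_le_sin`).
-/

namespace Summit.Parity.BatemanHorn.Theorems

open Finset Polynomial
open Literature.NumberTheory.Sieve (polyRootCountMod polyRootCountMod_single)

/-! ### The additive character `e(k/q)` and orthogonality on `ℤ/q` -/

/-- The additive character `e(k/q) = exp(2πik/q)` of `ℤ/q`, as a function of `k ∈ ℤ`. [folklore] -/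
noncomputable def eAdd (q : ℕ) (k : ℤ) : ℂ :=
  Complex.exp (2 * Real.pi * Complex.I * k / q)

/-- `e(k/q) = ζ_q^k` with `ζ_q = exp(2πi/q)`. [folklore] -/
theorem eAdd_eq_zpow (q : ℕ) (k : ℤ) :
    eAdd q k = Complex.exp (2 * Real.pi * Complex.I / q) ^ k := by
  rw [eAdd, ← Complex.exp_int_mul]
  congr 1
  ring

/-- `e(0) = 1`. [folklore] -/
theorem eAdd_zero (q : ℕ) : eAdd q 0 = 1 := by
  simp [eAdd]

/-- `e((a+b)/q) = e(a/q)e(b/q)`. [folklore] -/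
theorem eAdd_add (q : ℕ) (a b : ℤ) : eAdd q (a + b) = eAdd q a * eAdd q b := by
  rw [eAdd, eAdd, eAdd, ← Complex.exp_add]
  congr 1
  push_cast
  ring

/-- `|e(k/q)| = 1`. [folklore] -/
theorem norm_eAdd (q : ℕ) (k : ℤ) : ‖eAdd q k‖ = 1 := by
  rw [eAdd, show (2 * Real.pi * Complex.I * k / q : ℂ) = ((2 * Real.pi * k / q : ℝ) : ℂ) * Complex.I by
    push_cast; ring]
  exact Complex.norm_exp_ofReal_mul_I _

/-- `e(nk/q) = e(k/q)^n`. [folklore] -/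
theorem eAdd_nat_mul (q n : ℕ) (k : ℤ) : eAdd q (n * k) = eAdd q k ^ n := by
  rw [eAdd, eAdd, ← Complex.exp_nat_mul]
  congr 1
  push_cast
  ring

/-- **Orthogonality of additive characters**: `∑_{h<q} e(hk/q) = q·[q ∣ k]`. [folklore] -/
theorem sum_range_eAdd_mul (q : ℕ) (k : ℤ) :
    ∑ h ∈ range q, eAdd q (h * k) = if (q : ℤ) ∣ k then (q : ℂ) else 0 := by
  rcases Nat.eq_zero_or_pos q with rfl | hq
  · simp
  set ζ := Complex.exp (2 * Real.pi * Complex.I / q) with hζdef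
  have hζ : IsPrimitiveRoot ζ q := Complex.isPrimitiveRoot_exp q hq.ne'
  have hterm : ∀ h ∈ range q, eAdd q (h * k) = (ζ ^ k) ^ h := by
    intro h _
    rw [eAdd_nat_mul, eAdd_eq_zpow]
  rw [sum_congr rfl hterm]
  by_cases hk : (q : ℤ) ∣ k
  · rw [if_pos hk, (hζ.zpow_eq_one_iff_dvd k).mpr hk]
    simp
  · rw [if_neg hk]
    have hne : ζ ^ k ≠ 1 := fun h1 => hk ((hζ.zpow_eq_one_iff_dvd k).mp h1)
    rw [geom_sum_eq hne]
    have hpow : (ζ ^ k) ^ q = 1 := by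
      rw [← zpow_natCast, ← zpow_mul, mul_comm, zpow_mul, zpow_natCast, hζ.pow_eq_one, one_zpow]
    rw [hpow, sub_self, zero_div]

/-- Residues `m, ν < q` are congruent modulo `q` iff they are equal. [folklore] -/
theorem int_dvd_sub_iff_eq_of_lt {q m ν : ℕ} (hm : m < q) (hν : ν < q) :
    (q : ℤ) ∣ (ν : ℤ) - (m : ℤ) ↔ ν = m := by
  constructor
  · intro h
    have hmod : m ≡ ν [MOD q] := (Nat.modEq_iff_dvd).mpr h
    exact (Nat.ModEq.eq_of_lt_of_lt hmod hm hν).symm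
  · rintro rfl
    simp

/-- **Finite Fourier counting on `ℤ/q`**: for sets of residues `A, B ⊆ [0, q)`,
`∑_{h<q} (∑_{m∈B} e(−hm/q))·(∑_{ν∈A} e(hν/q)) = q·#(A ∩ B)`. [folklore] -/
theorem sum_kernel_mul_charSum_eq_card_inter {q : ℕ} {A B : Finset ℕ}
    (hA : ∀ ν ∈ A, ν < q) (hB : ∀ m ∈ B, m < q) :
    ∑ h ∈ range q, (∑ m ∈ B, eAdd q (-(h * m))) * (∑ ν ∈ A, eAdd q (h * ν))
      = (q : ℂ) * #(A ∩ B) := by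
  calc ∑ h ∈ range q, (∑ m ∈ B, eAdd q (-(h * m))) * (∑ ν ∈ A, eAdd q (h * ν))
      = ∑ h ∈ range q, ∑ m ∈ B, ∑ ν ∈ A, eAdd q (h * ((ν : ℤ) - m)) := by
        refine sum_congr rfl fun h _ => ?_
        rw [sum_mul_sum]
        refine sum_congr rfl fun m _ => sum_congr rfl fun ν _ => ?_
        rw [← eAdd_add]
        congr 1
        ring
    _ = ∑ m ∈ B, ∑ ν ∈ A, ∑ h ∈ range q, eAdd q (h * ((ν : ℤ) - m)) := by
        rw [sum_comm]
        exact sum_congr rfl fun m _ => sum_comm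
    _ = ∑ m ∈ B, ∑ ν ∈ A, if ν = m then (q : ℂ) else 0 := by
        refine sum_congr rfl fun m hm => sum_congr rfl fun ν hν => ?_
        rw [sum_range_eAdd_mul]
        exact if_congr (int_dvd_sub_iff_eq_of_lt (hB m hm) (hA ν hν)) rfl rfl
    _ = ∑ m ∈ B, if m ∈ A then (q : ℂ) else 0 := by
        refine sum_congr rfl fun m _ => ?_
        rw [sum_ite_eq']
    _ = (q : ℂ) * #(A ∩ B) := by
        rw [← sum_filter, filter_mem_eq_inter, sum_const, nsmul_eq_mul, mul_comm, inter_comm]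

/-! ### Roots modulo `q`, the Hooley sum and the interval kernel -/

/-- The roots of `g` modulo `q` among the residues `0, …, q − 1`. [folklore] -/
def rootResidues (g : ℤ[X]) (q : ℕ) : Finset ℕ :=
  (range q).filter fun ν => (q : ℤ) ∣ g.eval (ν : ℤ)

/-- Membership in `rootResidues`. [folklore] -/
theorem mem_rootResidues {g : ℤ[X]} {q ν : ℕ} :
    ν ∈ rootResidues g q ↔ ν < q ∧ (q : ℤ) ∣ g.eval (ν : ℤ) := by
  rw [rootResidues, mem_filter, mem_range]

/-- Root residues are `< q`. [folklore] -/
theorem rootResidues_lt (g : ℤ[X]) (q : ℕ) : ∀ ν ∈ rootResidues g q, ν < q :=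
  fun _ hν => (mem_rootResidues.mp hν).1

/-- `#(rootResidues g q) = ρ_g(q)`. [folklore] -/
theorem card_rootResidues (g : ℤ[X]) (q : ℕ) : #(rootResidues g q) = polyRootCountMod ![g] q := by
  rw [polyRootCountMod_single]
  rfl

/-- HOOLEY'S EXPONENTIAL SUM over the roots of `g` modulo `q`:
`S_g(h; q) = ∑_{ν mod q, g(ν) ≡ 0 (mod q)} e(hν/q)`.
C. Hooley, *On the distribution of the roots of polynomial congruences*, Mathematika 11 (1964), 39–49. -/
noncomputable def hooleySum (g : ℤ[X]) (q : ℕ) (h : ℤ) : ℂ :=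
  ∑ ν ∈ rootResidues g q, eAdd q (h * ν)

/-- `S_g(0; q) = ρ_g(q)`. [folklore] -/
theorem hooleySum_zero (g : ℤ[X]) (q : ℕ) : hooleySum g q 0 = polyRootCountMod ![g] q := by
  unfold hooleySum
  simp only [zero_mul, eAdd_zero, sum_const, nsmul_eq_mul, mul_one, card_rootResidues]

/-- The trivial bound `|S_g(h; q)| ≤ ρ_g(q)`. [folklore] -/
theorem norm_hooleySum_le (g : ℤ[X]) (q : ℕ) (h : ℤ) :
    ‖hooleySum g q h‖ ≤ polyRootCountMod ![g] q := by
  unfold hooleySum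
  refine (norm_sum_le _ _).trans ?_
  rw [← card_rootResidues]
  calc ∑ ν ∈ rootResidues g q, ‖eAdd q (h * ν)‖ = ∑ _ν ∈ rootResidues g q, (1 : ℝ) :=
        sum_congr rfl fun ν _ => norm_eAdd _ _
    _ = #(rootResidues g q) := by rw [sum_const, nsmul_eq_mul, mul_one]
    _ ≤ #(rootResidues g q) := le_rfl

/-- The INTERVAL KERNEL `F_{[a,b]}(h; q) = ∑_{a ≤ m ≤ b} e(−hm/q)` (the finite Fourier transform of the indicator of
`[a, b]` on `ℤ/q`). [folklore] -/
noncomputable def intervalKernel (q a b : ℕ) (h : ℤ) : ℂ :=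
  ∑ m ∈ Icc a b, eAdd q (-(h * m))

/-- `F_{[a,b]}(0; q) = b + 1 − a`. [folklore] -/
theorem intervalKernel_zero (q a b : ℕ) : intervalKernel q a b 0 = ((b + 1 - a : ℕ) : ℂ) := by
  unfold intervalKernel
  simp only [zero_mul, neg_zero, eAdd_zero, sum_const, Nat.card_Icc, nsmul_eq_mul, mul_one]

/-- The trivial bound `|F_{[a,b]}(h; q)| ≤ b + 1 − a`. [folklore] -/
theorem norm_intervalKernel_le_card (q a b : ℕ) (h : ℤ) :
    ‖intervalKernel q a b h‖ ≤ ((b + 1 - a : ℕ) : ℝ) := by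
  unfold intervalKernel
  refine (norm_sum_le _ _).trans ?_
  calc ∑ m ∈ Icc a b, ‖eAdd q (-(h * m))‖ = ∑ _m ∈ Icc a b, (1 : ℝ) :=
        sum_congr rfl fun m _ => norm_eAdd _ _
    _ = ((b + 1 - a : ℕ) : ℝ) := by rw [sum_const, Nat.card_Icc, nsmul_eq_mul, mul_one]
    _ ≤ ((b + 1 - a : ℕ) : ℝ) := le_rfl

/-- The kernel is a geometric sum: `F_{[a,b]}(h; q)·(w − 1) = w^{b+1} − w^a` with `w = e(−h/q)`. [folklore] -/
theorem intervalKernel_mul_sub_one (q a b : ℕ) (h : ℤ) (hab : a ≤ b + 1) :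
    intervalKernel q a b h * (eAdd q (-h) - 1) = eAdd q (-h) ^ (b + 1) - eAdd q (-h) ^ a := by
  unfold intervalKernel
  have hterm : ∀ m ∈ Icc a b, eAdd q (-(h * m)) = eAdd q (-h) ^ m := by
    intro m _
    rw [← eAdd_nat_mul]
    congr 1
    ring
  have hI : Icc a b = Ico a (b + 1) := by
    ext m
    simp only [mem_Icc, mem_Ico]
    omega
  rw [sum_congr rfl hterm, hI, geom_sum_Ico_mul _ hab]

/-- `|e(−h/q) − 1| = 2|sin(πh/q)|`. [folklore] -/
theorem norm_eAdd_neg_sub_one (q : ℕ) (h : ℤ) :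
    ‖eAdd q (-h) - 1‖ = 2 * |Real.sin (Real.pi * h / q)| := by
  have e1 : eAdd q (-h) = Complex.exp (Complex.I * ((-(2 * Real.pi * h / q) : ℝ) : ℂ)) := by
    rw [eAdd]
    congr 1
    push_cast
    ring
  rw [e1, Complex.norm_exp_I_mul_ofReal_sub_one, Real.norm_eq_abs, abs_mul, abs_two,
    show (-(2 * Real.pi * h / q) : ℝ) / 2 = -(Real.pi * h / q) by ring, Real.sin_neg, abs_neg]

/-- The geometric-sum bound `|F_{[a,b]}(h; q)| ≤ 1/|sin(πh/q)|` for `q ∤ h`. [folklore] -/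
theorem norm_intervalKernel_le_inv_sin {q : ℕ} (hq0 : q ≠ 0) (a b : ℕ) {h : ℤ} (hqh : ¬ (q : ℤ) ∣ h) :
    ‖intervalKernel q a b h‖ ≤ 1 / |Real.sin (Real.pi * h / q)| := by
  have hw : eAdd q (-h) ≠ 1 := by
    intro h1
    rw [eAdd_eq_zpow] at h1
    have := ((Complex.isPrimitiveRoot_exp q hq0).zpow_eq_one_iff_dvd (-h)).mp h1
    exact hqh ((dvd_neg).mp this)
  have hnorm_pos : 0 < ‖eAdd q (-h) - 1‖ := norm_pos_iff.mpr (sub_ne_zero.mpr hw)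
  have hsin_pos : 0 < |Real.sin (Real.pi * h / q)| := by
    have := norm_eAdd_neg_sub_one q h
    linarith
  rcases le_or_gt a (b + 1) with hab | hab
  · have hid := intervalKernel_mul_sub_one q a b h hab
    have h2 : ‖intervalKernel q a b h‖ * ‖eAdd q (-h) - 1‖ ≤ 2 := by
      rw [← norm_mul, hid]
      refine (norm_sub_le _ _).trans ?_
      rw [norm_pow, norm_pow, norm_eAdd, one_pow, one_pow]
      norm_num
    rw [norm_eAdd_neg_sub_one] at h2
    rw [le_div_iff₀ hsin_pos]
    linarith
  · have hemp : Icc a b = ∅ := Finset.Icc_eq_empty (by omega)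
    unfold intervalKernel
    rw [hemp, sum_empty, norm_zero]
    positivity

/-- Jordan's inequality in the form `|sin(πh/q)| ≥ 2·min(h, q−h)/q` for `0 < h < q`. [folklore] -/
theorem two_mul_min_div_le_abs_sin {q h : ℕ} (h0 : 0 < h) (hq : h < q) :
    2 * ((min h (q - h) : ℕ) : ℝ) / q ≤ |Real.sin (Real.pi * h / q)| := by
  have hqpos : (0 : ℝ) < q := by exact_mod_cast (h0.trans hq)
  have key : ∀ j : ℕ, 2 * j ≤ q → 2 * (j : ℝ) / q ≤ Real.sin (Real.pi * j / q) := by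
    intro j hj
    have hj' : (2 : ℝ) * j ≤ q := by exact_mod_cast hj
    have ht0 : 0 ≤ Real.pi * j / q := by positivity
    have ht1 : Real.pi * j / q ≤ Real.pi / 2 := by
      rw [div_le_div_iff₀ hqpos two_pos]
      nlinarith [Real.pi_pos]
    have := Real.mul_le_sin ht0 ht1
    calc 2 * (j : ℝ) / q = 2 / Real.pi * (Real.pi * j / q) := by field_simp
      _ ≤ Real.sin (Real.pi * j / q) := this
  rcases le_or_gt (2 * h) q with hle | hgt
  · have hmin : min h (q - h) = h := min_eq_left (by omega)
    rw [hmin]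
    exact (key h hle).trans (le_abs_self _)
  · have hmin : min h (q - h) = q - h := min_eq_right (by omega)
    rw [hmin]
    have hsym : Real.sin (Real.pi * h / q) = Real.sin (Real.pi * (q - h : ℕ) / q) := by
      rw [← Real.sin_pi_sub]
      congr 1
      rw [Nat.cast_sub hq.le]
      field_simp
    rw [hsym]
    exact (key (q - h) (by omega)).trans (le_abs_self _)

/-- **The Pólya–Vinogradov-type kernel bound** `|F_{[a,b]}(h; q)| ≤ q/(2·min(h, q−h))` for `0 < h < q`. [folklore] -/
theorem norm_intervalKernel_le_div (q a b : ℕ) {h : ℕ} (h0 : 0 < h) (hq : h < q) :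
    ‖intervalKernel q a b h‖ ≤ (q : ℝ) / (2 * ((min h (q - h) : ℕ) : ℝ)) := by
  have hmin_pos : (0 : ℝ) < ((min h (q - h) : ℕ) : ℝ) := by
    have : 0 < min h (q - h) := lt_min h0 (by omega)
    exact_mod_cast this
  have hqpos : (0 : ℝ) < q := by exact_mod_cast (h0.trans hq)
  have hndvd : ¬ (q : ℤ) ∣ (h : ℤ) := by
    intro hd
    have := Int.le_of_dvd (by exact_mod_cast h0) hd
    omega
  refine (norm_intervalKernel_le_inv_sin (by omega : q ≠ 0) a b hndvd).trans ?_
  have hj := two_mul_min_div_le_abs_sin h0 hq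
  have hlow : 0 < 2 * ((min h (q - h) : ℕ) : ℝ) / q := by positivity
  calc 1 / |Real.sin (Real.pi * (h : ℤ) / q)| = 1 / |Real.sin (Real.pi * h / q)| := by norm_cast
    _ ≤ 1 / (2 * ((min h (q - h) : ℕ) : ℝ) / q) := one_div_le_one_div_of_le hlow hj
    _ = (q : ℝ) / (2 * ((min h (q - h) : ℕ) : ℝ)) := by field_simp

/-- Both kernel bounds: `|F_{[a,b]}(h; q)| ≤ min(b + 1 − a, q/(2·min(h, q−h)))` for `0 < h < q`. [folklore] -/
theorem norm_intervalKernel_le_min (q a b : ℕ) {h : ℕ} (h0 : 0 < h) (hq : h < q) :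
    ‖intervalKernel q a b h‖ ≤ min ((b + 1 - a : ℕ) : ℝ) ((q : ℝ) / (2 * ((min h (q - h) : ℕ) : ℝ))) :=
  le_min (norm_intervalKernel_le_card q a b h) (norm_intervalKernel_le_div q a b h0 hq)

/-! ### Completion: roots in an interval -/

/-- **Exact finite-Fourier expansion of the number of roots in an interval**: for `b < q`,
`q · #{ν ∈ [a, b] : g(ν) ≡ 0 (mod q)} = ∑_{h<q} F_{[a,b]}(h; q)·S_g(h; q)`. [folklore] -/
theorem card_rootResidues_inter_Icc_mul_eq (g : ℤ[X]) {q a b : ℕ} (hb : b < q) :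
    (q : ℂ) * #(rootResidues g q ∩ Icc a b)
      = ∑ h ∈ range q, intervalKernel q a b h * hooleySum g q h := by
  rw [← sum_kernel_mul_charSum_eq_card_inter (rootResidues_lt g q)
    (fun m hm => (mem_Icc.mp hm).2.trans_lt hb)]
  rfl

/-- The same with the zero frequency (`= (b+1−a)·ρ_g(q)`) split off:
`q·#{roots in [a,b]} − (b+1−a)ρ_g(q) = ∑_{0<h<q} F_{[a,b]}(h; q)·S_g(h; q)`. [folklore] -/
theorem card_rootResidues_inter_Icc_mul_sub_eq (g : ℤ[X]) {q a b : ℕ} (hb : b < q) :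
    (q : ℂ) * #(rootResidues g q ∩ Icc a b) - ((b + 1 - a : ℕ) : ℂ) * polyRootCountMod ![g] q
      = ∑ h ∈ Ico 1 q, intervalKernel q a b h * hooleySum g q h := by
  have hq : 0 < q := by omega
  rw [card_rootResidues_inter_Icc_mul_eq g hb, range_eq_Ico, sum_eq_sum_Ico_succ_bot hq, Nat.cast_zero,
    intervalKernel_zero, hooleySum_zero]
  ring

/-- **The completion inequality** (Pólya–Vinogradov shape): for `b < q`,
`|#{roots of g mod q in [a,b]} − (b+1−a)ρ_g(q)/q| ≤ (1/q)·∑_{0<h<q} min(b+1−a, q/(2 min(h,q−h)))·|S_g(h; q)|`. [folklore] -/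
theorem abs_card_rootResidues_inter_Icc_sub_le (g : ℤ[X]) {q a b : ℕ} (hb : b < q) :
    |(#(rootResidues g q ∩ Icc a b) : ℝ) - ((b + 1 - a : ℕ) : ℝ) * polyRootCountMod ![g] q / q|
      ≤ (1 / q : ℝ) * ∑ h ∈ Ico 1 q,
          min ((b + 1 - a : ℕ) : ℝ) ((q : ℝ) / (2 * ((min h (q - h) : ℕ) : ℝ))) * ‖hooleySum g q h‖ := by
  have hq : 0 < q := by omega
  have hqpos : (0 : ℝ) < q := by exact_mod_cast hq
  have hid := card_rootResidues_inter_Icc_mul_sub_eq g (a := a) hb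
  have hnorm : ‖(q : ℂ) * #(rootResidues g q ∩ Icc a b) - ((b + 1 - a : ℕ) : ℂ) * polyRootCountMod ![g] q‖
      ≤ ∑ h ∈ Ico 1 q, min ((b + 1 - a : ℕ) : ℝ) ((q : ℝ) / (2 * ((min h (q - h) : ℕ) : ℝ)))
          * ‖hooleySum g q h‖ := by
    rw [hid]
    refine (norm_sum_le _ _).trans (sum_le_sum fun h hh => ?_)
    rw [mem_Ico] at hh
    rw [norm_mul]
    exact mul_le_mul_of_nonneg_right (norm_intervalKernel_le_min q a b hh.1 hh.2) (norm_nonneg _)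
  have hreal : ‖(q : ℂ) * #(rootResidues g q ∩ Icc a b) - ((b + 1 - a : ℕ) : ℂ) * polyRootCountMod ![g] q‖
      = |(q : ℝ) * #(rootResidues g q ∩ Icc a b) - ((b + 1 - a : ℕ) : ℝ) * polyRootCountMod ![g] q| := by
    rw [← Real.norm_eq_abs, ← Complex.norm_real]
    push_cast
    ring_nf
  rw [hreal] at hnorm
  have hscale : |(#(rootResidues g q ∩ Icc a b) : ℝ) - ((b + 1 - a : ℕ) : ℝ) * polyRootCountMod ![g] q / q|
      = (1 / q : ℝ) * |(q : ℝ) * #(rootResidues g q ∩ Icc a b)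
          - ((b + 1 - a : ℕ) : ℝ) * polyRootCountMod ![g] q| := by
    rw [← abs_of_pos (by positivity : (0 : ℝ) < 1 / q), ← abs_mul]
    congr 1
    field_simp
  rw [hscale]
  exact mul_le_mul_of_nonneg_left hnorm (by positivity)

end Summit.Parity.BatemanHorn.Theorems
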